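import Summits.Langlands.Langlands.Theses.SmithKummerSeed
import Summits.Langlands.Langlands.Theses.LiftDescend
import Summits.Langlands.Langlands.Theorems.IrreducibilityBySelfDualityReciprocityUpToIrreducibilityCorrespondsConj
import HarnessLib

/-!
# Glue for `SmithKummerSeed.CyclicPrimeDescent` (stmt-Langlands-18645) from its two registered stubs

Support file (closes nothing) for the crux chain of `AscentConjugationSolvable` (stmt-Langlands-1094; shared by
routes BaseFieldAscent / CMFern / SmithKummerSeed): the crux is the conjunction of the items stmt-Langlands-18649
`CyclicPrimeAscent` and stmt-Langlands-18645 `CyclicPrimeDescent` by the landed glue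
`BaseFieldAscentAscentConjugationSolvable.ascentConjugationSolvable_of_pieces` (p151345).  The crux strategist cut
`CyclicPrimeDescent` along the DIRECTION seam into two stubs registered on stmt-Langlands-18645
(`Cruxes/AscentConjugationSolvable/Lines/CyclicPrimeDescent_birth.lean`, commit 5a756faadb…, 2026-08-17):

* `stub_descentAutToGal` — for `L/K` Galois of prime degree and full reciprocity over `L`, reciprocity data
  `R` for `K` carrying direction (A) in every rank (THE OPEN CORE of the conjugation-solvable ascent:
  solvable NON-NORMAL base change, the twist ambiguity at inert places; Arthur–Clozel Ch. 3 §7, Rajan 2002);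
* `stub_descentWeakGalToAut` — weak direction (B) over `K` (a.e. Satake–Frobenius matching) for the same `R`,
  from reciprocity over `L` and (A) over `K` (cyclic descent / automorphic induction + Clifford theory).

This file LANDS the strategist's kernel-checked composition, with the two stub statements written out VERBATIM
as hypotheses (a Cruxes work-file is not an importable module), so that a planner `--split` of
stmt-Langlands-18645 into those stubs is glued BY NAME (`cyclicPrimeDescent_of_stubs`), exactly as
stmt-Langlands-19073 was glued by `SmithKummerSeedAscentConjugationSolvableSplit.lean` (p147205).  The
composition is not a one-line seam: weak (B) is UPGRADED to the summit's `GaloisToAutomorphic` (local–global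
compatibility at every finite place) by the landed Chebotarev–Brauer–Nesbitt transport
`ReciprocityUpToIrreducibility.corresponds_of_exists_corresponds`, packaged here as
`galoisToAutomorphic_of_weak` — whose statement is VERBATIM the body of item stmt-Langlands-1065
`LiftDescend.WeakToStrongGalToAut` (open, unserved at 2026-08-17T12:50Z; a prover holding that item closes it by
`exact galoisToAutomorphic_of_weak`).

No `sorry`, no new definition, no named-fact hypothesis; standard axioms.

References: J. Arthur, L. Clozel, *Simple algebras, base change, and the advanced theory of the trace formula*,
Ann. of Math. Stud. 120 (1989), Ch. 3 Thm. 4.2; P. Deligne, J.-P. Serre, *Formes modulaires de poids 1*,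
ASENS 7 (1974), Lemme 3.2; K. Buzzard, T. Gee, LMS Lecture Note Ser. 414 (2014), Conj. 3.2.2.
-/

noncomputable section

set_option linter.dupNamespace false -- project-wide option; `Summit.Langlands.Langlands` is the mandated namespace

namespace Summit.Langlands.Langlands.Theorems.SmithKummerSeedCyclicPrimeDescent

open Summit.Langlands Summit.Langlands.Langlands.Theses.SmithKummerSeed
open Filter

/-- **Weak-to-strong upgrade of direction (B), for the same reciprocity data** (VERBATIM the body of item
stmt-Langlands-1065 `LiftDescend.WeakToStrongGalToAut`): if (A) holds for `R` in every rank and every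
irreducible `R`-geometric `ρ` is Satake–Frobenius compatible at almost all places with some L-algebraic
cuspidal `π`, then (B) holds for `R` — (A) gives some `ρ'` corresponding to that `π` at every finite place,
`ρ'` and `ρ` are two avatars of `π` with `ρ` irreducible, hence conjugate (Chebotarev density + Brauer–Nesbitt),
and `Corresponds` descends to conjugacy classes (`corresponds_of_exists_corresponds`, landed).
[cite: DeligneSerreASENS1974, Lemme 3.2] [cite: BuzzardGeeLMS2014, Conj. 3.2.2] -/
theorem galoisToAutomorphic_of_weak (F : Type) [Field F] [NumberField F] (R : ReciprocityData F)
    (hA : ∀ n : ℕ, 0 < n →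
      ∀ hcpt : Literature.NumberTheory.Automorphic.isCompact_glFiniteIntegralLevel n F,
        AutomorphicToGalois n R hcpt)
    (hW : ∀ (n : ℕ), 0 < n → ∀ (ℓ : ℕ) [Fact ℓ.Prime] (ι : PadicAlgCl ℓ ≃+* ℂ)
      (ρ : Literature.NumberTheory.GaloisRepresentations.FramedGaloisRep F (PadicAlgCl ℓ) n),
      ρ.toGaloisRep.IsIrreducible → IsGeometricFramed R ρ →
        ∀ hcpt : Literature.NumberTheory.Automorphic.isCompact_glFiniteIntegralLevel n F,
          ∃ π : Literature.NumberTheory.Automorphic.CuspidalAutomorphicRepData n F hcpt,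
            π.1.IsLAlgebraic ∧
              ∀ᶠ v : IsDedekindDomain.HeightOneSpectrum (NumberField.RingOfIntegers F) in cofinite,
                SatakeFrobCompatibleAt ι π.1 ρ v) :
    ∀ n : ℕ, 0 < n →
      ∀ hcpt : Literature.NumberTheory.Automorphic.isCompact_glFiniteIntegralLevel n F,
        GaloisToAutomorphic n R hcpt := by
  intro n hn hcpt ℓ _ ι ρ hirr hgeo
  obtain ⟨π, hL, hsat⟩ := hW n hn ℓ ι ρ hirr hgeo hcpt
  obtain ⟨ρ', -, -, hcorr', -⟩ := hA n hn hcpt π hL ℓ ι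
  exact ⟨π, hL,
    Theorems.ReciprocityUpToIrreducibility.corresponds_of_exists_corresponds hirr hsat ⟨ρ', hcorr'⟩⟩

/-- **Item stmt-Langlands-1065 `LiftDescend.WeakToStrongGalToAut` BY NAME, proved** (the curried form of
`galoisToAutomorphic_of_weak`; this file is not proposed `--workitem stmt-Langlands-1065` — the lead of
stmt-Langlands-1094 does not hold that item — so it closes nothing here; the prover who holds it may release it
`--by` this declaration). [cite: DeligneSerreASENS1974, Lemme 3.2] -/
theorem weakToStrongGalToAut_proof :
    Summit.Langlands.Langlands.Theses.LiftDescend.WeakToStrongGalToAut :=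
  fun F _ _ R hA hW => galoisToAutomorphic_of_weak F R hA hW

/-- **`CyclicPrimeDescent` (stmt-Langlands-18645) from its two registered stubs, BY NAME.** Hypotheses:
`h₁` = VERBATIM the registered signature of `stub_descentAutToGal` (reciprocity data `R` for `K` with
direction (A) in every rank, from full reciprocity over the prime-degree Galois extension `L`), `h₂` = VERBATIM
the registered signature of `stub_descentWeakGalToAut` (weak (B) over `K` for that `R`).  Proof: take `R` and
(A) from `h₁`, weak (B) from `h₂`, upgrade by `galoisToAutomorphic_of_weak`; then
`GlobalLanglandsCorrespondenceGLn n K R hcpt = (A) ∧ (B)` for every `n ≥ 1`.  (Strategist's composition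
`Cruxes/AscentConjugationSolvable/Lines/CyclicPrimeDescent_birth.lean :: CyclicPrimeDescent_of`, landed.) [folklore] -/
theorem cyclicPrimeDescent_of_stubs : (∀ (K L : Type) [Field K] [NumberField K] [Field L] [NumberField L] [Algebra K L] [IsGalois K L], (Module.finrank K L).Prime → (∃ R : ReciprocityData L, ∀ n : ℕ, 0 < n → ∀ hcpt : Literature.NumberTheory.Automorphic.isCompact_glFiniteIntegralLevel n L, GlobalLanglandsCorrespondenceGLn n L R hcpt) → ∃ R : ReciprocityData K, ∀ n : ℕ, 0 < n → ∀ hcpt : Literature.NumberTheory.Automorphic.isCompact_glFiniteIntegralLevel n K, AutomorphicToGalois n R hcpt) → (∀ (K L : Type) [Field K] [NumberField K] [Field L] [NumberField L] [Algebra K L] [IsGalois K L] (R : ReciprocityData K), (Module.finrank K L).Prime → (∃ R₁ : ReciprocityData L, ∀ n : ℕ, 0 < n → ∀ hcpt : Literature.NumberTheory.Automorphic.isCompact_glFiniteIntegralLevel n L, GlobalLanglandsCorrespondenceGLn n L R₁ hcpt) → (∀ n : ℕ, 0 < n → ∀ hcpt : Literature.NumberTheory.Automorphic.isCompact_glFiniteIntegralLevel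 n K, AutomorphicToGalois n R hcpt) → ∀ (n : ℕ), 0 < n → ∀ (ℓ : ℕ) [Fact ℓ.Prime] (ι : PadicAlgCl ℓ ≃+* ℂ) (ρ : Literature.NumberTheory.GaloisRepresentations.FramedGaloisRep K (PadicAlgCl ℓ) n), ρ.toGaloisRep.IsIrreducible → IsGeometricFramed R ρ → ∀ hcpt : Literature.NumberTheory.Automorphic.isCompact_glFiniteIntegralLevel n K, ∃ π : Literature.NumberTheory.Automorphic.CuspidalAutomorphicRepData n K hcpt, π.1.IsLAlgebraic ∧ ∀ᶠ v : IsDedekindDomain.HeightOneSpectrum (NumberField.RingOfIntegers K) in cofinite, SatakeFrobCompatibleAt ι π.1 ρ v) → Summit.Langlands.Langlands.Theses.SmithKummerSeed.CyclicPrimeDescent := by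
  intro h₁ h₂ K L _ _ _ _ _ _ hp hL
  obtain ⟨R, hAR⟩ := h₁ K L hp hL
  exact ⟨R, fun n hn hcpt =>
    ⟨hAR n hn hcpt, galoisToAutomorphic_of_weak K R hAR (h₂ K L R hp hL hAR) n hn hcpt⟩⟩

end Summit.Langlands.Langlands.Theorems.SmithKummerSeedCyclicPrimeDescent

end
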